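import Literature.NumberTheory.EllipticCurves.AnalyticRankWindow
import Literature.NumberTheory.EllipticCurves.AnalyticRankForcingSchema
import HarnessLib

/-!
# What is missing at the wall: `r_an = 2 ⇒ rank ≤ 2` (the rank-2 converse) is EQUIVALENT to
# "`w = +1` and three independent points force `ord_{s=1} L(E,s) ≥ 4`"

Topic `NumberTheory/EllipticCurves`, namespace `Literature.NumberTheory.EllipticCurves` (continuing
`AnalyticRankWindow.lean`). Everything here is PROVED (theorems only; the open statements enter as
HYPOTHESES, never as named facts).

For an elliptic `W / ℚ`, `r_an = W.analyticRank`, `rank = W.mordellWeilRank = rank_ℤ E(ℚ)`,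
`w = W.rootNumber`. Gross–Zagier–Kolyvagin (the tree's named fact
`rank_eq_analyticRank_of_analyticRank_le_one`, Darmon 2004 Thm. 3.22) is the statement
"`r_an ≤ 1 ⇒ rank = r_an`"; it converts `rank ≥ 2` into `r_an ≥ 2` and nothing more (Cremona 1997,
§2.13, p. 37: "when `L(f,s)` has a zero of order `r = 0` or `1` at `s = 1` then the rank of `E_f` is
exactly `r`"). The census of the Goldfeld track (rh-explicit, 2026) locates the obstruction to a
provable order `≥ 4` for a primitive `L`-function over `ℚ` in the absence of the next rung,
"`T₂`: `r_an = 2 ⇒ rank ≤ 2`" (the analytic-rank-`2` case of `rank ≤ r_an`, a consequence of the Birch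
and Swinnerton-Dyer conjecture; no Euler-system or height argument is known to give it). This file
types that location:

* `succ_le_analyticRank_of_rank_le` / `add_two_le_analyticRank_of_rank_le` — the general ladder: if
  `rank ≤ r_an` is known for all curves with `r_an ≤ n` (hypothesis `hRA`), then `rank ≥ n + 1` gives
  `r_an ≥ n + 1`, and with the sign `w = (−1)ⁿ` (parity fact `WeierstrassCurve.even_analyticRank_iff`)
  even `r_an ≥ n + 2`;
* `four_le_analyticRank_of_rankTwoConverse` — **the `T₂`-schema**: GZK, `T₂`, `w = +1`, `rank ≥ 3` ⇒
  `r_an ≥ 4`; `analyticRank_eq_four_of_rankTwoConverse` — with `L⁗(E,1) ≠ 0` also `r_an = 4` (the wall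
  instance `234446a`: rank `4` exact, `w = +1`, `L⁗(E,1)/4! = 8.94…` certified);
* `five_le_analyticRank_of_rankThreeConverse` — **the `T₃`-schema**, parity UNCONDITIONAL
  (`w = −1`): GZK, `T₃ : r_an = 3 ⇒ rank ≤ 3`, `rank ≥ 4` ⇒ `r_an ≥ 5` (the rank-`5` curve
  `19047851a`);
* `rankTwoConverse_iff_wall` — **the equivalence**: given GZK and parity for every curve, `T₂` holds
  iff every elliptic `E / ℚ` with `w(E) = +1` and `rank ≥ 3` has `r_an ≥ 4`. So the census's missing
  certificate "U1" and the missing theorem `T₂` are the same statement.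

OWNERSHIP (goldfeld track ruling, 2026-08-22): the schema statements `T_k ⇒ …` are OWNED by
`AnalyticRankForcingSchema.lean` (`le_analyticRank_of_forall_lt`,
`four_le_analyticRank_of_rank_le_of_analyticRank_eq_two`, `five_le_analyticRank_of_rank_le_of_analyticRank_eq_three`,
landed first); the four ladder/schema theorems below are kept with their statements (slightly weaker
hypotheses: `rank ≥ 3` with per-curve parity, resp. `rank ≥ 4`) but are now PROVED from that file;
what this file adds is the two equivalences `rankTwoConverse_iff_wall`, `rankThreeConverse_iff_wall`
and the exact forms with a certified derivative.

Sources: Cremona, *Algorithms for Modular Elliptic Curves* (1997), §2.13 p. 37 (the certificates and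
"the problem of deciding whether `L^{(k)}(f,1) = 0`"); Darmon 2004 Thm. 3.22 (GZK); Silverman AEC C.16
Thm. 16.3 and remark (parity). Not here: any claim that `T₂` holds.
-/

noncomputable section

open WeierstrassCurve

namespace Literature.NumberTheory.EllipticCurves

section Ladder

variable (W : WeierstrassCurve ℚ) [W.IsElliptic]

/-- **One rung from `rank ≤ r_an` below `n`.** If `rank_ℤ E'(ℚ) ≤ r_an(E')` for every elliptic
`E' / ℚ` with `r_an(E') ≤ n` (hypothesis `hRA`; for `n = 1` this is Gross–Zagier–Kolyvagin), then
`rank ≥ n + 1` forces `r_an ≥ n + 1` (Cremona 1997, §2.13, p. 37, the step "`E_f` has rank `3` …, so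
again the analytic rank must be at least `3`", one rung up). [cite: CremonaAlgorithms1997, §2.13 p. 37] -/
theorem succ_le_analyticRank_of_rank_le {n : ℕ}
    (hRA : ∀ (W' : WeierstrassCurve ℚ) [W'.IsElliptic],
      W'.analyticRank ≤ n → W'.mordellWeilRank ≤ W'.analyticRank)
    (hr : n + 1 ≤ W.mordellWeilRank) : n + 1 ≤ W.analyticRank :=
  le_analyticRank_of_forall_lt W (fun k hk V _ hV => by have := hRA V (by omega); omega) hr

/-- **Two rungs with the sign.** Under the same hypothesis `hRA` below `n`, the parity fact
(`WeierstrassCurve.even_analyticRank_iff`, hypothesis `hpar`) and the sign `w(E) = (−1)ⁿ`, `rank ≥ n + 1`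
forces `r_an ≥ n + 2` (`r_an ≥ n + 1` and `r_an ≡ n (mod 2)`). [cite: CremonaAlgorithms1997, §2.13 p. 37]
[cite: SilvermanAEC2009, C.16 Thm. 16.3 and remark, p. 451] -/
theorem add_two_le_analyticRank_of_rank_le {n : ℕ}
    (hRA : ∀ (W' : WeierstrassCurve ℚ) [W'.IsElliptic],
      W'.analyticRank ≤ n → W'.mordellWeilRank ≤ W'.analyticRank)
    (hpar : W.even_analyticRank_iff) (hw : W.rootNumber = (-1) ^ n)
    (hr : n + 1 ≤ W.mordellWeilRank) : n + 2 ≤ W.analyticRank := by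
  have h1 := succ_le_analyticRank_of_rank_le W hRA hr
  have h' : Even W.analyticRank ↔ W.rootNumber = 1 := hpar
  rcases Nat.even_or_odd n with hn | hn
  · rw [hn.neg_one_pow] at hw
    obtain ⟨k, hk⟩ := h'.mpr hw
    obtain ⟨m, hm⟩ := hn
    omega
  · rw [hn.neg_one_pow] at hw
    have hodd : ¬ Even W.analyticRank := fun he => by
      have := h'.mp he; rw [hw] at this; norm_num at this
    obtain ⟨k, hk⟩ := Nat.not_even_iff_odd.mp hodd
    obtain ⟨m, hm⟩ := hn
    omega

end Ladder

/-! ### The `T₂`- and `T₃`-schemas -/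

section Schemas

variable (W : WeierstrassCurve ℚ) [W.IsElliptic]

/-- **The `T₂`-schema (sign `+1`).** Assume Gross–Zagier–Kolyvagin (`hGZK`), the parity fact for `W`
(`hpar`), and the rank-`2` converse `T₂ : r_an(E') = 2 ⇒ rank_ℤ E'(ℚ) ≤ 2` for all elliptic `E' / ℚ`
(hypothesis `hT2` — NOT a theorem). Then `w(W) = +1` and `rank_ℤ W(ℚ) ≥ 3` force `ord_{s=1} L(W,s) ≥ 4`:
`r_an ≠ 0, 1` by GZK, `≠ 2` by `T₂`, `≠ 3` by parity. For `234446a` (rank `4` exact) this is the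
missing certificate. [cite: CremonaAlgorithms1997, §2.13 p. 37] [cite: Darmon2004, Thm. 3.22] -/
theorem four_le_analyticRank_of_rankTwoConverse
    (hGZK : rank_eq_analyticRank_of_analyticRank_le_one)
    (hT2 : ∀ (W' : WeierstrassCurve ℚ) [W'.IsElliptic], W'.analyticRank = 2 → W'.mordellWeilRank ≤ 2)
    (hpar : W.even_analyticRank_iff) (hw : W.rootNumber = 1) (h3 : 3 ≤ W.mordellWeilRank) :
    4 ≤ W.analyticRank := by
  have h2 := two_le_analyticRank_of_two_le_mordellWeilRank' W hGZK (by omega)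
  have hne := analyticRank_ne_of_rank_le_of_analyticRank_eq W hT2 (by omega)
  have h' : Even W.analyticRank ↔ W.rootNumber = 1 := hpar
  obtain ⟨k, hk⟩ := h'.mpr hw
  omega

/-- **`T₂` pins the wall instance to `r_an = 4`**: with `L(W, ·)` entire and a certified `L⁗(W,1) ≠ 0` in
addition, `ord_{s=1} L(W,s) = 4` (`234446a`: `L⁗(E,1)/4! = 8.9438…`, two lineages).
[cite: CremonaAlgorithms1997, §2.13 p. 37] -/
theorem analyticRank_eq_four_of_rankTwoConverse (hL : W.HasEntireLFunction)
    (hGZK : rank_eq_analyticRank_of_analyticRank_le_one)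
    (hT2 : ∀ (W' : WeierstrassCurve ℚ) [W'.IsElliptic], W'.analyticRank = 2 → W'.mordellWeilRank ≤ 2)
    (hpar : W.even_analyticRank_iff) (hw : W.rootNumber = 1) (h3 : 3 ≤ W.mordellWeilRank)
    (h4 : iteratedDeriv 4 W.entireLFunction 1 ≠ 0) : W.analyticRank = 4 :=
  le_antisymm (analyticRank_le_of_iteratedDeriv_ne_zero W hL h4)
    (four_le_analyticRank_of_rankTwoConverse W hGZK hT2 hpar hw h3)

/-- **The `T₃`-schema (sign `−1`, parity unconditional).** Assume GZK and the rank-`3` converse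
`T₃ : r_an(E') = 3 ⇒ rank_ℤ E'(ℚ) ≤ 3` (hypothesis). Then `w(W) = −1` and `rank_ℤ W(ℚ) ≥ 4` force
`ord_{s=1} L(W,s) ≥ 5`: `r_an ≥ 2` by GZK, odd by `w = −1`
(`WeierstrassCurve.odd_analyticRank_of_rootNumber_eq_neg_one`, no modularity input), `≠ 3` by `T₃`.
The rank-`5` curve `19047851a` is the instance. [cite: CremonaAlgorithms1997, §2.13 p. 37]
[cite: Darmon2004, Thm. 3.22] -/
theorem five_le_analyticRank_of_rankThreeConverse
    (hGZK : rank_eq_analyticRank_of_analyticRank_le_one)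
    (hT3 : ∀ (W' : WeierstrassCurve ℚ) [W'.IsElliptic], W'.analyticRank = 3 → W'.mordellWeilRank ≤ 3)
    (hw : W.rootNumber = -1) (h4 : 4 ≤ W.mordellWeilRank) : 5 ≤ W.analyticRank := by
  have h2 := two_le_analyticRank_of_two_le_mordellWeilRank' W hGZK (by omega)
  have hne3 := analyticRank_ne_of_rank_le_of_analyticRank_eq W hT3 (by omega)
  obtain ⟨k, hk⟩ := odd_analyticRank_of_rootNumber_eq_neg_one hw
  omega

/-- With a certified `L⁽⁵⁾(W,1) ≠ 0` in addition, the `T₃`-schema gives `ord_{s=1} L(W,s) = 5`.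
[cite: CremonaAlgorithms1997, §2.13 p. 37] -/
theorem analyticRank_eq_five_of_rankThreeConverse
    (hGZK : rank_eq_analyticRank_of_analyticRank_le_one)
    (hT3 : ∀ (W' : WeierstrassCurve ℚ) [W'.IsElliptic], W'.analyticRank = 3 → W'.mordellWeilRank ≤ 3)
    (hw : W.rootNumber = -1) (h4 : 4 ≤ W.mordellWeilRank)
    (h5 : iteratedDeriv 5 W.entireLFunction 1 ≠ 0) : W.analyticRank = 5 :=
  le_antisymm (analyticRank_le_of_iteratedDeriv_ne_zero W (hasEntireLFunction_of_rootNumber_eq_neg_one hw) h5)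
    (five_le_analyticRank_of_rankThreeConverse W hGZK hT3 hw h4)

end Schemas

/-! ### The equivalence: `T₂` IS the wall statement -/

/-- **`T₂` ⟺ the wall.** Given Gross–Zagier–Kolyvagin and the parity fact for every elliptic curve over
`ℚ`, the rank-`2` converse `T₂ : ∀ E, r_an(E) = 2 → rank_ℤ E(ℚ) ≤ 2` holds if and only if every elliptic
`E / ℚ` with `w(E) = +1` and `rank_ℤ E(ℚ) ≥ 3` has `ord_{s=1} L(E,s) ≥ 4`. (`⇒` is the `T₂`-schema; `⇐`: if
`r_an(E) = 2` then `w(E) = +1` by parity, and `rank ≥ 3` would give `r_an ≥ 4`.) So the census's missing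
CERTIFICATE for `234446a` and the missing THEOREM `T₂` are one statement.
[cite: CremonaAlgorithms1997, §2.13 p. 37] [cite: Darmon2004, Thm. 3.22]
[cite: SilvermanAEC2009, C.16 Thm. 16.3 and remark, p. 451] -/
theorem rankTwoConverse_iff_wall (hGZK : rank_eq_analyticRank_of_analyticRank_le_one)
    (hpar : ∀ (W : WeierstrassCurve ℚ) [W.IsElliptic], W.even_analyticRank_iff) :
    (∀ (W : WeierstrassCurve ℚ) [W.IsElliptic], W.analyticRank = 2 → W.mordellWeilRank ≤ 2) ↔
      ∀ (W : WeierstrassCurve ℚ) [W.IsElliptic],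
        W.rootNumber = 1 → 3 ≤ W.mordellWeilRank → 4 ≤ W.analyticRank := by
  constructor
  · intro hT2 W _ hw h3
    exact four_le_analyticRank_of_rankTwoConverse W hGZK hT2 (hpar W) hw h3
  · intro hwall W _ h2
    by_contra h3
    have h' : Even W.analyticRank ↔ W.rootNumber = 1 := hpar W
    have hw : W.rootNumber = 1 := h'.mp (by rw [h2]; exact even_two)
    have := hwall W hw (by omega)
    omega

/-- The same for `T₃`, with parity unconditional on the `w = −1` side: given GZK and parity, `T₃ : ∀ E,
r_an(E) = 3 → rank_ℤ E(ℚ) ≤ 3` holds iff every elliptic `E / ℚ` with `w(E) = −1` and `rank ≥ 4` has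
`r_an ≥ 5`. [cite: CremonaAlgorithms1997, §2.13 p. 37] [cite: Darmon2004, Thm. 3.22] -/
theorem rankThreeConverse_iff_wall (hGZK : rank_eq_analyticRank_of_analyticRank_le_one)
    (hpar : ∀ (W : WeierstrassCurve ℚ) [W.IsElliptic], W.even_analyticRank_iff) :
    (∀ (W : WeierstrassCurve ℚ) [W.IsElliptic], W.analyticRank = 3 → W.mordellWeilRank ≤ 3) ↔
      ∀ (W : WeierstrassCurve ℚ) [W.IsElliptic],
        W.rootNumber = -1 → 4 ≤ W.mordellWeilRank → 5 ≤ W.analyticRank := by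
  constructor
  · intro hT3 W _ hw h4
    exact five_le_analyticRank_of_rankThreeConverse W hGZK hT3 hw h4
  · intro hwall W _ h3
    by_contra h4
    have h' : Even W.analyticRank ↔ W.rootNumber = 1 := hpar W
    have hw : W.rootNumber = -1 := by
      rcases W.rootNumber_eq_one_or with h1 | h1
      · exfalso
        obtain ⟨k, hk⟩ := h'.mpr h1
        omega
      · exact h1
    have := hwall W hw (by omega)
    omega

end Literature.NumberTheory.EllipticCurves
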